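import Summits.CriticalPhenomena.PercolationContinuityZ3.Theorems.PercNearOneGluingNoHeavyLowerTailThreePointHubGraphs
import Summits.CriticalPhenomena.PercolationContinuityZ3.Theorems.PercNearOneGluingNoHeavyLowerTailThreePointPieces
import HarnessLib

/-!
# The halving lemma (v) is closed under PARALLEL COMPOSITION at the three terminals; (v) on every hub graph `H_k`, all weights
# (Sahi programme, prover prim-sahi-p2 gen 45)

Support file (`--supports stmt-CriticalPhenomena-4575`, helper).  No definitions, no named facts, no sorries; standard axioms.
Memo `run/shared/lean/prim/prim-sahi/FROM-prim-sahi-p2-gen45-PARALLEL-CLOSURE.md`; `prim-sahi-p2/PROOF-E3.md` §55.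

SETTING.  `μ = prodBernoulli w` on a finite vertex type, three vertices `s, a, c` (`a` distinguished).  ISOLATION COORDINATES:
`I_a = μ(a ↮ s, a ↮ c)`, `I_s = μ(s ↮ a, s ↮ c)`, `I_c = μ(c ↮ a, c ↮ s)` (a terminal is separated from the other two) and
`q = μ(s|a|c)`; the five partition cells are `p₀ = q`, `p₁ = μ(sa|c) = I_c − q`, `p₂ = μ(ac|s) = I_s − q`, `p₃ = μ(sc|a) = I_a − q`,
`T = 1 − I_a − I_s − I_c + 2q`.  In these coordinates the HALVING LEMMA (v) `μ(U)μ(D) ≤ 2μ(U ∩ D)` (`U = {s↔a} ∪ {c↔a}`, `D = {s↮c}`;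
equivalently `T·p₀ ≤ (1+p₃)(p₁+p₂)`, `…ThreePointHalvingTransplant`, open in general) reads

  `(v)   q·(3 + I_a) ≤ (1 + I_a)·(I_s + I_c)`        (`halvingUD_of_iso` does the bookkeeping).

PARALLEL COMPOSITION.  Gluing two weighted graphs at `s, a, c` (no other common vertex; equivalently: a weight function in which two
non-terminals of different pieces are never joined) MULTIPLIES the four isolation coordinates (a terminal is separated from the other
two iff it is so inside every piece) — prim-l12-p1's piece calculus (`ThreePointPieces`, `ThreePointHubGraphs`).
* `halving_mul` [this work] — THE CLOSURE ALGEBRA: if `0 ≤ qᵢ ≤ Bᵢ, Cᵢ`, `0 ≤ Aᵢ ≤ 1` and `qᵢ(3+Aᵢ) ≤ (1+Aᵢ)(Bᵢ+Cᵢ)` (`i = 1,2`) then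
  `q₁q₂(3 + A₁A₂) ≤ (1 + A₁A₂)(B₁B₂ + C₁C₂)`.  Certificate (`ring`):
  `(1+A₁)(1+A₂)·slack = (1+A₁A₂)[(1+A₁)q₁S₂ + (1+A₂)q₂S₁ + (1+A₁)(1+A₂)((B₁−q₁)(B₂−q₂) + (C₁−q₁)(C₂−q₂))] + q₁q₂(1−A₁A₂)(1−A₁)(1−A₂)`
  (`Sᵢ` the slack of factor `i`): the region of (v) is a multiplicative semigroup.  `halving_prod` is the `Finset`-product form.
* `star_halving`, `tri_halving` [this work] — a single hub (pairs `a–h, s–h, c–h` of weights `x, y, z`) and the terminal triangle satisfy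
  (v) in isolation coordinates; both slacks are multiples of `S(u,v) = v(1−u) + u(1−v)(1 − v(1−u)) ≥ 0` (`S_nonneg`).
* **`halvingIso_of_pieces`, `halvingUD_of_pieces`** [this work] — THE PARALLEL-CLOSURE THEOREM at measure level: for a piece structure
  `part : V → ι` (non-terminals of different pieces never joined), if every piece satisfies (v) in its own isolation coordinates (the
  cylinder probabilities `isoPiece (piecePairs a s c part i) …` of `ThreePointPieces`), then the whole graph satisfies (v)
  (`real_isoP`, `real_sepP` product formulas + `halving_prod` + the triangle factor).
* **`halvingIso_hubGraph`, `halvingUD_hubGraph`** [this work] — (v) holds, for ALL weights, on every HUB GRAPH (every pair of non-terminal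
  vertices has weight `0`; contains all weighted `K_{3,k}`, the hub family `H_k = {h₁..h_k} × {s,a,c}` and, with zero weights, `K_{2,k}` and
  the paths): the product formulas `ThreePointHubGraphs.isoA_eq/isoB_eq/isoC_eq/sep_eq` + `halving_prod` + the two factor lemmas.
  These families carried the adversarial law-level infimum `μ(U∩D)/(μ(U)μ(D)) → 0.835…` of the (v) line (gens 41–44); now settled.
Nothing here asserts (v) for general graphs.
-/

namespace Summit.CriticalPhenomena.PercolationContinuityZ3.Theorems.HalvingParallel

open MeasureTheory Set
open Literature.Probability.Percolation Literature.Probability.LatticeModels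
open Summit.CriticalPhenomena.PercolationContinuityZ3.Theorems.ThreePointHubEvents
open Summit.CriticalPhenomena.PercolationContinuityZ3.Theorems.ThreePointHubGraphs

/-! ## The closure algebra -/

/-- **Parallel closure of (v), two factors.**  In isolation coordinates `(A, B, C, q) = (I_a, I_s, I_c, μ(s|a|c))` the region
`q(3+A) ≤ (1+A)(B+C)` (with the automatic `0 ≤ q ≤ B, C`, `0 ≤ A ≤ 1`) is closed under coordinatewise products. [this work] -/
theorem halving_mul {A₁ B₁ C₁ q₁ A₂ B₂ C₂ q₂ : ℝ} (hA₁ : 0 ≤ A₁) (hA₁1 : A₁ ≤ 1) (hA₂ : 0 ≤ A₂) (hA₂1 : A₂ ≤ 1)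
    (hq₁ : 0 ≤ q₁) (hq₂ : 0 ≤ q₂) (hB₁ : q₁ ≤ B₁) (hC₁ : q₁ ≤ C₁) (hB₂ : q₂ ≤ B₂) (hC₂ : q₂ ≤ C₂)
    (h₁ : q₁ * (3 + A₁) ≤ (1 + A₁) * (B₁ + C₁)) (h₂ : q₂ * (3 + A₂) ≤ (1 + A₂) * (B₂ + C₂)) :
    q₁ * q₂ * (3 + A₁ * A₂) ≤ (1 + A₁ * A₂) * (B₁ * B₂ + C₁ * C₂) := by
  have key : (1 + A₁) * (1 + A₂) * ((1 + A₁ * A₂) * (B₁ * B₂ + C₁ * C₂) - q₁ * q₂ * (3 + A₁ * A₂)) =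
      (1 + A₁ * A₂) * (1 + A₁) * q₁ * ((1 + A₂) * (B₂ + C₂) - q₂ * (3 + A₂)) +
        (1 + A₁ * A₂) * (1 + A₂) * q₂ * ((1 + A₁) * (B₁ + C₁) - q₁ * (3 + A₁)) +
        (1 + A₁ * A₂) * (1 + A₁) * (1 + A₂) * ((B₁ - q₁) * (B₂ - q₂) + (C₁ - q₁) * (C₂ - q₂)) +
        q₁ * q₂ * (1 - A₁ * A₂) * (1 - A₁) * (1 - A₂) := by ring
  have ha : 0 ≤ 1 + A₁ * A₂ := by positivity
  have t1 : 0 ≤ (1 + A₁ * A₂) * (1 + A₁) * q₁ * ((1 + A₂) * (B₂ + C₂) - q₂ * (3 + A₂)) :=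
    mul_nonneg (mul_nonneg (mul_nonneg ha (by linarith)) hq₁) (by linarith)
  have t2 : 0 ≤ (1 + A₁ * A₂) * (1 + A₂) * q₂ * ((1 + A₁) * (B₁ + C₁) - q₁ * (3 + A₁)) :=
    mul_nonneg (mul_nonneg (mul_nonneg ha (by linarith)) hq₂) (by linarith)
  have t3 : 0 ≤ (1 + A₁ * A₂) * (1 + A₁) * (1 + A₂) * ((B₁ - q₁) * (B₂ - q₂) + (C₁ - q₁) * (C₂ - q₂)) :=
    mul_nonneg (mul_nonneg (mul_nonneg ha (by linarith)) (by linarith))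
      (add_nonneg (mul_nonneg (by linarith) (by linarith)) (mul_nonneg (by linarith) (by linarith)))
  have hA12 : A₁ * A₂ ≤ 1 := by nlinarith
  have t4 : 0 ≤ q₁ * q₂ * (1 - A₁ * A₂) * (1 - A₁) * (1 - A₂) :=
    mul_nonneg (mul_nonneg (mul_nonneg (mul_nonneg hq₁ hq₂) (by linarith)) (by linarith)) (by linarith)
  have hpos : 0 < (1 + A₁) * (1 + A₂) := by positivity
  have hprod : (1 + A₁) * (1 + A₂) * 0 ≤
      (1 + A₁) * (1 + A₂) * ((1 + A₁ * A₂) * (B₁ * B₂ + C₁ * C₂) - q₁ * q₂ * (3 + A₁ * A₂)) := by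
    rw [key, mul_zero]; linarith
  have : 0 ≤ (1 + A₁ * A₂) * (B₁ * B₂ + C₁ * C₂) - q₁ * q₂ * (3 + A₁ * A₂) := le_of_mul_le_mul_left hprod hpos
  linarith

/-- **Parallel closure of (v), finitely many factors.** [this work] -/
theorem halving_prod {ι : Type*} (S : Finset ι) (A B C q : ι → ℝ)
    (hA : ∀ i ∈ S, 0 ≤ A i) (hA1 : ∀ i ∈ S, A i ≤ 1) (hq : ∀ i ∈ S, 0 ≤ q i)
    (hB : ∀ i ∈ S, q i ≤ B i) (hC : ∀ i ∈ S, q i ≤ C i)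
    (h : ∀ i ∈ S, q i * (3 + A i) ≤ (1 + A i) * (B i + C i)) :
    (∏ i ∈ S, q i) * (3 + ∏ i ∈ S, A i) ≤ (1 + ∏ i ∈ S, A i) * ((∏ i ∈ S, B i) + ∏ i ∈ S, C i) := by
  classical
  induction S using Finset.induction_on with
  | empty => simp; norm_num
  | insert j S hj ih =>
    rw [Finset.prod_insert hj, Finset.prod_insert hj, Finset.prod_insert hj, Finset.prod_insert hj]
    have hS : ∀ {P : ι → Prop}, (∀ i ∈ insert j S, P i) → ∀ i ∈ S, P i := fun hP i hi => hP i (Finset.mem_insert_of_mem hi)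
    have hjm : j ∈ insert j S := Finset.mem_insert_self j S
    have ih' := ih (hS hA) (hS hA1) (hS hq) (hS hB) (hS hC) (hS h)
    exact halving_mul (hA j hjm) (hA1 j hjm) (Finset.prod_nonneg (hS hA)) (Finset.prod_le_one (hS hA) (hS hA1))
      (hq j hjm) (Finset.prod_nonneg (hS hq)) (hB j hjm) (hC j hjm)
      (Finset.prod_le_prod (hS hq) (hS hB)) (Finset.prod_le_prod (hS hq) (hS hC)) (h j hjm) ih'

/-- `S(u,v) = u + v − 3uv + u²v + uv² − u²v² = v(1−u) + u(1−v)(1 − v(1−u)) ≥ 0` on `[0,1]²` (the common slack factor of the hub and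
triangle pieces; `S = 0` exactly at `u = v = 0` and `u = v = 1`). [this work] -/
theorem S_nonneg {u v : ℝ} (hu : 0 ≤ u) (hu1 : u ≤ 1) (hv : 0 ≤ v) (hv1 : v ≤ 1) :
    0 ≤ u + v - 3 * u * v + u ^ 2 * v + u * v ^ 2 - u ^ 2 * v ^ 2 := by
  have h1 : 0 ≤ v * (1 - u) := mul_nonneg hv (by linarith)
  have h2 : 0 ≤ u * (1 - v) * (1 - v * (1 - u)) := mul_nonneg (mul_nonneg hu (by linarith)) (by nlinarith)
  nlinarith [h1, h2]

/-- **A single hub satisfies (v) in isolation coordinates.**  Hub `h` joined to `a, s, c` with probabilities `x, y, z`: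
`A = 1 − x(y+z−yz)` (a separated inside the piece), `B = 1 − y(x+z−xz)`, `C = 1 − z(x+y−xy)`, `q = 1 − xy − xz − yz + 2xyz`;
slack `= x·S(y,z)`. [this work] -/
theorem star_halving {x y z : ℝ} (hx : 0 ≤ x) (hy : 0 ≤ y) (hy1 : y ≤ 1) (hz : 0 ≤ z) (hz1 : z ≤ 1) :
    (1 - x * y - x * z - y * z + 2 * x * y * z) * (3 + (1 - x * (y + z - y * z))) ≤
      (1 + (1 - x * (y + z - y * z))) * ((1 - y * (x + z - x * z)) + (1 - z * (x + y - x * y))) := by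
  have hS := S_nonneg hy hy1 hz hz1
  have key : (1 + (1 - x * (y + z - y * z))) * ((1 - y * (x + z - x * z)) + (1 - z * (x + y - x * y))) -
      (1 - x * y - x * z - y * z + 2 * x * y * z) * (3 + (1 - x * (y + z - y * z))) =
      x * (y + z - 3 * y * z + y ^ 2 * z + y * z ^ 2 - y ^ 2 * z ^ 2) := by ring
  nlinarith [mul_nonneg hx hS, key]

/-- The hub piece has `q ≤ B` (`B − q = xz(1−y)`). [this work] -/
theorem star_q_le_B {x y z : ℝ} (hx : 0 ≤ x) (hy1 : y ≤ 1) (hz : 0 ≤ z) :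
    1 - x * y - x * z - y * z + 2 * x * y * z ≤ 1 - y * (x + z - x * z) := by
  nlinarith [mul_nonneg (mul_nonneg hx hz) (sub_nonneg.2 hy1)]

/-- The hub piece has `q ≤ C` (`C − q = xy(1−z)`). [this work] -/
theorem star_q_le_C {x y z : ℝ} (hx : 0 ≤ x) (hy : 0 ≤ y) (hz1 : z ≤ 1) :
    1 - x * y - x * z - y * z + 2 * x * y * z ≤ 1 - z * (x + y - x * y) := by
  nlinarith [mul_nonneg (mul_nonneg hx hy) (sub_nonneg.2 hz1)]

/-- The hub piece has `0 ≤ A ≤ 1`. [this work] -/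
theorem star_A_mem {x y z : ℝ} (hx : 0 ≤ x) (hx1 : x ≤ 1) (hy : 0 ≤ y) (hy1 : y ≤ 1) (hz : 0 ≤ z) (hz1 : z ≤ 1) :
    0 ≤ 1 - x * (y + z - y * z) ∧ 1 - x * (y + z - y * z) ≤ 1 := by
  have h0 : 0 ≤ y + z - y * z := by nlinarith [mul_nonneg hy (sub_nonneg.2 hz1)]
  have h1 : y + z - y * z ≤ 1 := by nlinarith [mul_nonneg (sub_nonneg.2 hy1) (sub_nonneg.2 hz1)]
  constructor
  · nlinarith [mul_le_mul hx1 h1 h0 zero_le_one]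
  · nlinarith [mul_nonneg hx h0]

/-- **The terminal triangle satisfies (v) in isolation coordinates.**  With `X = 1 − w(a,s)`, `Y = 1 − w(a,c)`, `Z = 1 − w(s,c)`:
`A = XY`, `B = XZ`, `C = YZ`, `q = XYZ`; slack `= Z·S(X,Y)`. [this work] -/
theorem tri_halving {X Y Z : ℝ} (hX : 0 ≤ X) (hX1 : X ≤ 1) (hY : 0 ≤ Y) (hY1 : Y ≤ 1) (hZ : 0 ≤ Z) :
    X * Y * Z * (3 + X * Y) ≤ (1 + X * Y) * (X * Z + Y * Z) := by
  have hS := S_nonneg hX hX1 hY hY1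
  have key : (1 + X * Y) * (X * Z + Y * Z) - X * Y * Z * (3 + X * Y) =
      Z * (X + Y - 3 * X * Y + X ^ 2 * Y + X * Y ^ 2 - X ^ 2 * Y ^ 2) := by ring
  nlinarith [mul_nonneg hZ hS, key]

/-! ## (v) on hub graphs -/

variable {V : Type*} [Fintype V] [DecidableEq V]

/-- **(v) IN ISOLATION COORDINATES ON EVERY HUB GRAPH, all weights.**  If every pair of vertices outside `{a, s, c}` has weight `0`
(each hub may be joined to each terminal, and the terminals to each other, with arbitrary weights), then
`μ(s|a|c)·(3 + I_a) ≤ (1 + I_a)·(I_s + I_c)` with `I_a = μ((a↔s)ᶜ ∩ (a↔c)ᶜ)`, `I_s = μ((a↔s)ᶜ ∩ (s↔c)ᶜ)`, `I_c = μ((a↔c)ᶜ ∩ (s↔c)ᶜ)`,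
`μ(s|a|c) = μ(((a↔s)ᶜ ∩ (a↔c)ᶜ) ∩ ((a↔s)ᶜ ∩ (s↔c)ᶜ))`. [this work] -/
theorem halvingIso_hubGraph (w : Sym2 V → unitInterval) {a s c : V} (has : a ≠ s) (hac : a ≠ c) (hsc : s ≠ c)
    (hw : ∀ u v : V, u ≠ a → u ≠ s → u ≠ c → v ≠ a → v ≠ s → v ≠ c → u ≠ v → (w s(u, v) : ℝ) = 0) :
    (prodBernoulli w).real (((openConn a s)ᶜ ∩ (openConn a c)ᶜ) ∩ ((openConn a s)ᶜ ∩ (openConn s c)ᶜ)) *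
        (3 + (prodBernoulli w).real ((openConn a s)ᶜ ∩ (openConn a c)ᶜ)) ≤
      (1 + (prodBernoulli w).real ((openConn a s)ᶜ ∩ (openConn a c)ᶜ)) *
        ((prodBernoulli w).real ((openConn a s)ᶜ ∩ (openConn s c)ᶜ) +
          (prodBernoulli w).real ((openConn a c)ᶜ ∩ (openConn s c)ᶜ)) := by
  have hN : (prodBernoulli w).real (bad a s c) = 0 := real_bad w fun u hu v hv huv => by
    obtain ⟨hua, hub, huc⟩ := mem_hubs.1 hu
    obtain ⟨hva, hvb, hvc⟩ := mem_hubs.1 hv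
    exact hw u v hua hub huc hva hvb hvc huv
  -- weights
  set α : V → ℝ := fun h => (w s(a, h) : ℝ) with hα
  set β : V → ℝ := fun h => (w s(s, h) : ℝ) with hβ
  set γ : V → ℝ := fun h => (w s(c, h) : ℝ) with hγ
  have h01 : ∀ h : V, 0 ≤ α h ∧ α h ≤ 1 ∧ 0 ≤ β h ∧ β h ≤ 1 ∧ 0 ≤ γ h ∧ γ h ≤ 1 := fun h =>
    ⟨unitInterval.nonneg _, unitInterval.le_one _, unitInterval.nonneg _, unitInterval.le_one _, unitInterval.nonneg _,
      unitInterval.le_one _⟩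
  set pas : ℝ := (w s(a, s) : ℝ)
  set pac : ℝ := (w s(a, c) : ℝ)
  set psc : ℝ := (w s(s, c) : ℝ)
  have hpas : 0 ≤ 1 - pas := sub_nonneg.2 (unitInterval.le_one _)
  have hpac : 0 ≤ 1 - pac := sub_nonneg.2 (unitInterval.le_one _)
  have hpsc : 0 ≤ 1 - psc := sub_nonneg.2 (unitInterval.le_one _)
  have hpas1 : 1 - pas ≤ 1 := sub_le_self _ (unitInterval.nonneg _)
  have hpac1 : 1 - pac ≤ 1 := sub_le_self _ (unitInterval.nonneg _)
  -- hub products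
  set PQ : ℝ := ∏ h ∈ hubs a s c, (1 - α h * β h - α h * γ h - β h * γ h + 2 * α h * β h * γ h) with hPQ
  set PA : ℝ := ∏ h ∈ hubs a s c, (1 - α h * (β h + γ h - β h * γ h)) with hPA
  set PB : ℝ := ∏ h ∈ hubs a s c, (1 - β h * (α h + γ h - α h * γ h)) with hPB
  set PC : ℝ := ∏ h ∈ hubs a s c, (1 - γ h * (α h + β h - α h * β h)) with hPC
  have eQ : (prodBernoulli w).real (((openConn a s)ᶜ ∩ (openConn a c)ᶜ) ∩ ((openConn a s)ᶜ ∩ (openConn s c)ᶜ)) =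
      (1 - pas) * (1 - pac) * (1 - psc) * PQ := sep_eq w has hac hsc hN
  have eA : (prodBernoulli w).real ((openConn a s)ᶜ ∩ (openConn a c)ᶜ) = (1 - pas) * (1 - pac) * PA := isoA_eq w has hac hsc hN
  have eB : (prodBernoulli w).real ((openConn a s)ᶜ ∩ (openConn s c)ᶜ) = (1 - pas) * (1 - psc) * PB := isoB_eq w has hac hsc hN
  have eC : (prodBernoulli w).real ((openConn a c)ᶜ ∩ (openConn s c)ᶜ) = (1 - pac) * (1 - psc) * PC := isoC_eq w has hac hsc hN
  -- the hub product satisfies (v) in isolation coordinates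
  have hP : PQ * (3 + PA) ≤ (1 + PA) * (PB + PC) :=
    halving_prod (hubs a s c) (fun h => 1 - α h * (β h + γ h - β h * γ h)) (fun h => 1 - β h * (α h + γ h - α h * γ h))
      (fun h => 1 - γ h * (α h + β h - α h * β h)) (fun h => 1 - α h * β h - α h * γ h - β h * γ h + 2 * α h * β h * γ h)
      (fun h _ => by obtain ⟨h1, h2, h3, h4, h5, h6⟩ := h01 h; exact (star_A_mem h1 h2 h3 h4 h5 h6).1)
      (fun h _ => by obtain ⟨h1, h2, h3, h4, h5, h6⟩ := h01 h; exact (star_A_mem h1 h2 h3 h4 h5 h6).2)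
      (fun h _ => by obtain ⟨h1, h2, h3, h4, h5, h6⟩ := h01 h; exact ThreePointIsoProduct.star_Q_nonneg h1 h2 h3 h4 h5 h6)
      (fun h _ => by obtain ⟨h1, h2, h3, h4, h5, h6⟩ := h01 h; exact star_q_le_B h1 h4 h5)
      (fun h _ => by obtain ⟨h1, h2, h3, h4, h5, h6⟩ := h01 h; exact star_q_le_C h1 h3 h6)
      (fun h _ => by obtain ⟨h1, h2, h3, h4, h5, h6⟩ := h01 h; exact star_halving h1 h3 h4 h5 h6)
  -- auxiliary bounds for the hub product
  have hQnn : ∀ h ∈ hubs a s c, 0 ≤ 1 - α h * β h - α h * γ h - β h * γ h + 2 * α h * β h * γ h := fun h _ => by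
    obtain ⟨h1, h2, h3, h4, h5, h6⟩ := h01 h; exact ThreePointIsoProduct.star_Q_nonneg h1 h2 h3 h4 h5 h6
  have hPQnn : 0 ≤ PQ := Finset.prod_nonneg hQnn
  have hPAnn : 0 ≤ PA := Finset.prod_nonneg fun h _ => by
    obtain ⟨h1, h2, h3, h4, h5, h6⟩ := h01 h; exact (star_A_mem h1 h2 h3 h4 h5 h6).1
  have hPA1 : PA ≤ 1 := Finset.prod_le_one (fun h _ => by
    obtain ⟨h1, h2, h3, h4, h5, h6⟩ := h01 h; exact (star_A_mem h1 h2 h3 h4 h5 h6).1) (fun h _ => by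
    obtain ⟨h1, h2, h3, h4, h5, h6⟩ := h01 h; exact (star_A_mem h1 h2 h3 h4 h5 h6).2)
  have hPQB : PQ ≤ PB := Finset.prod_le_prod hQnn fun h _ => by
    obtain ⟨h1, h2, h3, h4, h5, h6⟩ := h01 h; exact star_q_le_B h1 h4 h5
  have hPQC : PQ ≤ PC := Finset.prod_le_prod hQnn fun h _ => by
    obtain ⟨h1, h2, h3, h4, h5, h6⟩ := h01 h; exact star_q_le_C h1 h3 h6
  -- the triangle factor satisfies (v), and the two factors combine
  have hT : (1 - pas) * (1 - pac) * (1 - psc) * (3 + (1 - pas) * (1 - pac)) ≤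
      (1 + (1 - pas) * (1 - pac)) * ((1 - pas) * (1 - psc) + (1 - pac) * (1 - psc)) := tri_halving hpas hpas1 hpac hpac1 hpsc
  have hmul := halving_mul (A₁ := (1 - pas) * (1 - pac)) (B₁ := (1 - pas) * (1 - psc)) (C₁ := (1 - pac) * (1 - psc))
    (q₁ := (1 - pas) * (1 - pac) * (1 - psc)) (A₂ := PA) (B₂ := PB) (C₂ := PC) (q₂ := PQ)
    (mul_nonneg hpas hpac) (by nlinarith [mul_le_mul hpas1 hpac1 hpac zero_le_one]) hPAnn hPA1
    (mul_nonneg (mul_nonneg hpas hpac) hpsc) hPQnn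
    (by nlinarith [mul_nonneg (mul_nonneg hpas hpsc) (sub_nonneg.2 hpac1)])
    (by nlinarith [mul_nonneg (mul_nonneg hpac hpsc) (sub_nonneg.2 hpas1)]) hPQB hPQC hT hP
  rw [eQ, eA, eB, eC]
  calc (1 - pas) * (1 - pac) * (1 - psc) * PQ * (3 + (1 - pas) * (1 - pac) * PA)
      = (1 - pas) * (1 - pac) * (1 - psc) * PQ * (3 + (1 - pas) * (1 - pac) * PA) := rfl
    _ ≤ (1 + (1 - pas) * (1 - pac) * PA) * ((1 - pas) * (1 - psc) * PB + (1 - pac) * (1 - psc) * PC) := by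
        have := hmul; ring_nf; ring_nf at this; linarith

omit [DecidableEq V] in
/-- **From isolation coordinates to the `U, D` form.**  On any weighted graph, `μ(s|a|c)·(3 + I_a) ≤ (1 + I_a)·(I_s + I_c)` gives
`μ(U)·μ(D) ≤ 2·μ(U ∩ D)` with `U = {s↔a} ∪ {c↔a}`, `D = {s↮c}` (in fact the two are equivalent: `μ(U) = 1 − I_a`, `μ(D) = I_s + I_c − q`,
`μ(U ∩ D) = I_s + I_c − 2q`). [this work] -/
theorem halvingUD_of_iso (w : Sym2 V → unitInterval) {a s c : V}
    (hiso : (prodBernoulli w).real (((openConn a s)ᶜ ∩ (openConn a c)ᶜ) ∩ ((openConn a s)ᶜ ∩ (openConn s c)ᶜ)) *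
        (3 + (prodBernoulli w).real ((openConn a s)ᶜ ∩ (openConn a c)ᶜ)) ≤
      (1 + (prodBernoulli w).real ((openConn a s)ᶜ ∩ (openConn a c)ᶜ)) *
        ((prodBernoulli w).real ((openConn a s)ᶜ ∩ (openConn s c)ᶜ) +
          (prodBernoulli w).real ((openConn a c)ᶜ ∩ (openConn s c)ᶜ))) :
    (prodBernoulli w).real (openConn s a ∪ openConn c a) * (prodBernoulli w).real ((openConn s c)ᶜ) ≤
      2 * (prodBernoulli w).real ((openConn s a ∪ openConn c a) ∩ (openConn s c)ᶜ) := by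
  set μ := prodBernoulli w with hμ
  set IA : Set (BondConfig V) := (openConn a s)ᶜ ∩ (openConn a c)ᶜ with hIA
  set IB : Set (BondConfig V) := (openConn a s)ᶜ ∩ (openConn s c)ᶜ with hIB
  set IC : Set (BondConfig V) := (openConn a c)ᶜ ∩ (openConn s c)ᶜ with hIC
  have hsymm : ∀ x y : V, (openConn x y : Set (BondConfig V)) = openConn y x := fun x y =>
    Set.ext fun _ => ⟨fun h => SimpleGraph.Reachable.symm h, fun h => SimpleGraph.Reachable.symm h⟩
  -- set identities
  have hU : (openConn s a ∪ openConn c a : Set (BondConfig V)) = IAᶜ := by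
    rw [hIA, Set.compl_inter, compl_compl, compl_compl, hsymm s a, hsymm c a]
  have hD : ((openConn s c)ᶜ : Set (BondConfig V)) = IB ∪ IC := by
    ext ω
    simp only [hIB, hIC, mem_union, mem_inter_iff, mem_compl_iff]
    constructor
    · intro h
      by_cases has' : ω ∈ openConn a s
      · refine Or.inr ⟨fun hac' => h ?_, h⟩
        exact SimpleGraph.Reachable.trans (SimpleGraph.Reachable.symm has') hac'
      · exact Or.inl ⟨has', h⟩
    · rintro (⟨-, h⟩ | ⟨-, h⟩) <;> exact h
  have hBC : IB ∩ IC = IA ∩ IB := by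
    ext ω
    simp only [hIA, hIB, hIC, mem_inter_iff, mem_compl_iff]
    tauto
  have hUD : ((openConn s a ∪ openConn c a) ∩ (openConn s c)ᶜ : Set (BondConfig V)) = (IB ∪ IC) \ (IA ∩ IB) := by
    rw [hU, hD]
    ext ω
    simp only [mem_inter_iff, mem_compl_iff, mem_sdiff, mem_union, hIA, hIB, hIC]
    tauto
  -- probabilities
  have hμU : μ.real (openConn s a ∪ openConn c a) = 1 - μ.real IA := by
    rw [hU, measureReal_compl MeasurableSet.of_discrete, probReal_univ]
  have hμD : μ.real ((openConn s c)ᶜ) = μ.real IB + μ.real IC - μ.real (IA ∩ IB) := by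
    have h := measureReal_union_add_inter (μ := μ) (s := IB) (t := IC) MeasurableSet.of_discrete
    rw [hD, ← hBC]; linarith
  have hμUD : μ.real ((openConn s a ∪ openConn c a) ∩ (openConn s c)ᶜ) =
      μ.real IB + μ.real IC - 2 * μ.real (IA ∩ IB) := by
    have hsub : IA ∩ IB ⊆ IB ∪ IC := fun ω hω => Or.inl hω.2
    have h1 := measureReal_inter_add_sdiff₀ (μ := μ) (s := IB ∪ IC) (t := IA ∩ IB)
      (MeasurableSet.of_discrete).nullMeasurableSet
    have h2 := measureReal_union_add_inter (μ := μ) (s := IB) (t := IC) MeasurableSet.of_discrete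
    rw [Set.inter_eq_self_of_subset_right hsub] at h1
    rw [hBC] at h2
    rw [hUD]; linarith
  rw [hμU, hμD, hμUD]
  nlinarith [hiso]


/-- **THE HALVING LEMMA (v) ON EVERY HUB GRAPH, all weights**: `μ(U)·μ(D) ≤ 2·μ(U ∩ D)` with `U = {s↔a} ∪ {c↔a}`, `D = {s↮c}`,
whenever every pair of vertices outside `{a, s, c}` has weight `0` (all weighted `K_{3,k}`; the hub family `H_k`; with zero weights
also `K_{2,k}` and the path `s–a–c`).  [this work] -/
theorem halvingUD_hubGraph (w : Sym2 V → unitInterval) {a s c : V} (has : a ≠ s) (hac : a ≠ c) (hsc : s ≠ c)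
    (hw : ∀ u v : V, u ≠ a → u ≠ s → u ≠ c → v ≠ a → v ≠ s → v ≠ c → u ≠ v → (w s(u, v) : ℝ) = 0) :
    (prodBernoulli w).real (openConn s a ∪ openConn c a) * (prodBernoulli w).real ((openConn s c)ᶜ) ≤
      2 * (prodBernoulli w).real ((openConn s a ∪ openConn c a) ∩ (openConn s c)ᶜ) :=
  halvingUD_of_iso w (halvingIso_hubGraph w has hac hsc hw)

/-! ## (v) for parallel compositions of arbitrary pieces -/

section pieces

open Summit.CriticalPhenomena.PercolationContinuityZ3.Theorems.ThreePointPieces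

variable {ι : Type*} [Fintype ι] [DecidableEq ι]

omit [Fintype V] [DecidableEq V] in
/-- Inside a piece, "all three separated" implies "`c` separated from `a` and `s`". [this work] -/
theorem sepPiece_subset_isoPiece_c (F : Finset (Sym2 V)) (a s c : V) :
    isoPiece F a s c ∩ isoPiece F s a c ⊆ isoPiece F c a s := by
  rintro ω ⟨⟨-, hac⟩, -, hsc⟩
  exact ⟨fun h => hac (SimpleGraph.Reachable.symm h), fun h => hsc (SimpleGraph.Reachable.symm h)⟩

/-- **PARALLEL CLOSURE OF (v) (measure level).**  Let `part : V → ι` label the vertices and suppose two non-terminal vertices with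
different labels are never joined (weight `0`): the weighted graph is a parallel composition, at `a, s, c`, of its pieces.  For piece `i`
with pair set `F i = piecePairs a s c part i` write `qᵢ = μ(a|s|c inside i)`, `Aᵢ = μ(a separated from s, c inside i)`,
`Bᵢ = μ(s separated inside i)`, `Cᵢ = μ(c separated inside i)` (the cylinder events `isoPiece (F i) · · ·`).  If EVERY PIECE satisfies
(v) in isolation coordinates, `qᵢ(3 + Aᵢ) ≤ (1 + Aᵢ)(Bᵢ + Cᵢ)`, then so does the whole graph:
`μ(s|a|c)·(3 + I_a) ≤ (1 + I_a)·(I_s + I_c)`. [this work] -/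
theorem halvingIso_of_pieces (w : Sym2 V → unitInterval) {a s c : V} (has : a ≠ s) (hac : a ≠ c) (hsc : s ≠ c)
    (part : V → ι) (hw : ∀ u v : V, u ∉ terms a s c → v ∉ terms a s c → part u ≠ part v → (w s(u, v) : ℝ) = 0)
    (hV : ∀ i, (prodBernoulli w).real (isoPiece (piecePairs a s c part i) a s c ∩ isoPiece (piecePairs a s c part i) s a c) *
        (3 + (prodBernoulli w).real (isoPiece (piecePairs a s c part i) a s c)) ≤
      (1 + (prodBernoulli w).real (isoPiece (piecePairs a s c part i) a s c)) *
        ((prodBernoulli w).real (isoPiece (piecePairs a s c part i) s a c) +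
          (prodBernoulli w).real (isoPiece (piecePairs a s c part i) c a s))) :
    (prodBernoulli w).real (((openConn a s)ᶜ ∩ (openConn a c)ᶜ) ∩ ((openConn a s)ᶜ ∩ (openConn s c)ᶜ)) *
        (3 + (prodBernoulli w).real ((openConn a s)ᶜ ∩ (openConn a c)ᶜ)) ≤
      (1 + (prodBernoulli w).real ((openConn a s)ᶜ ∩ (openConn a c)ᶜ)) *
        ((prodBernoulli w).real ((openConn a s)ᶜ ∩ (openConn s c)ᶜ) +
          (prodBernoulli w).real ((openConn a c)ᶜ ∩ (openConn s c)ᶜ)) := by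
  have hN : (prodBernoulli w).real (badP a s c part) = 0 := real_badP w a s c part hw
  set μ := prodBernoulli w with hμ
  set F : ι → Finset (Sym2 V) := fun i => piecePairs a s c part i with hF
  set PQ : ℝ := ∏ i ∈ (Finset.univ : Finset ι), μ.real (isoPiece (F i) a s c ∩ isoPiece (F i) s a c) with hPQ
  set Pa : ℝ := ∏ i ∈ (Finset.univ : Finset ι), μ.real (isoPiece (F i) a s c) with hPa
  set Ps : ℝ := ∏ i ∈ (Finset.univ : Finset ι), μ.real (isoPiece (F i) s a c) with hPs
  set Pc : ℝ := ∏ i ∈ (Finset.univ : Finset ι), μ.real (isoPiece (F i) c a s) with hPc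
  set pas : ℝ := (w s(a, s) : ℝ)
  set pac : ℝ := (w s(a, c) : ℝ)
  set psc : ℝ := (w s(s, c) : ℝ)
  have hpas : 0 ≤ 1 - pas := sub_nonneg.2 (unitInterval.le_one _)
  have hpac : 0 ≤ 1 - pac := sub_nonneg.2 (unitInterval.le_one _)
  have hpsc : 0 ≤ 1 - psc := sub_nonneg.2 (unitInterval.le_one _)
  have hpas1 : 1 - pas ≤ 1 := sub_le_self _ (unitInterval.nonneg _)
  have hpac1 : 1 - pac ≤ 1 := sub_le_self _ (unitInterval.nonneg _)
  have eQ : μ.real (((openConn a s)ᶜ ∩ (openConn a c)ᶜ) ∩ ((openConn a s)ᶜ ∩ (openConn s c)ᶜ)) =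
      (1 - pas) * (1 - pac) * (1 - psc) * PQ := by
    rw [hμ, real_sepP' w part has hac hsc hN, real_sepP, real_tClosed_inter w has hac hsc]
  have eA : μ.real ((openConn a s)ᶜ ∩ (openConn a c)ᶜ) = (1 - pas) * (1 - pac) * Pa := by
    rw [hμ, real_isoPa w part has hac hN, real_isoP w a s c part (mem_terms.2 (Or.inl rfl)) (mem_terms.2 (Or.inr (Or.inl rfl)))
      (mem_terms.2 (Or.inr (Or.inr rfl))), real_tClosed w hsc]
  have eS : μ.real ((openConn a s)ᶜ ∩ (openConn s c)ᶜ) = (1 - pas) * (1 - psc) * Ps := by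
    rw [hμ, real_isoPb w part has hsc hN, real_isoP w a s c part (mem_terms.2 (Or.inr (Or.inl rfl))) (mem_terms.2 (Or.inl rfl))
      (mem_terms.2 (Or.inr (Or.inr rfl))), real_tClosed w hac, Sym2.eq_swap (a := s) (b := a)]
  have eC : μ.real ((openConn a c)ᶜ ∩ (openConn s c)ᶜ) = (1 - pac) * (1 - psc) * Pc := by
    rw [hμ, real_isoPc w part hac hsc hN, real_isoP w a s c part (mem_terms.2 (Or.inr (Or.inr rfl))) (mem_terms.2 (Or.inl rfl))
      (mem_terms.2 (Or.inr (Or.inl rfl))), real_tClosed w has, Sym2.eq_swap (a := c) (b := a), Sym2.eq_swap (a := c) (b := s)]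
  -- the product of the pieces satisfies (v) in isolation coordinates
  have hQnn : ∀ i ∈ (Finset.univ : Finset ι), 0 ≤ μ.real (isoPiece (F i) a s c ∩ isoPiece (F i) s a c) :=
    fun _ _ => measureReal_nonneg
  have hQB : ∀ i ∈ (Finset.univ : Finset ι),
      μ.real (isoPiece (F i) a s c ∩ isoPiece (F i) s a c) ≤ μ.real (isoPiece (F i) s a c) :=
    fun _ _ => measureReal_mono Set.inter_subset_right
  have hQC : ∀ i ∈ (Finset.univ : Finset ι),
      μ.real (isoPiece (F i) a s c ∩ isoPiece (F i) s a c) ≤ μ.real (isoPiece (F i) c a s) :=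
    fun i _ => measureReal_mono (sepPiece_subset_isoPiece_c (F i) a s c)
  have hP : PQ * (3 + Pa) ≤ (1 + Pa) * (Ps + Pc) :=
    halving_prod Finset.univ (fun i => μ.real (isoPiece (F i) a s c)) (fun i => μ.real (isoPiece (F i) s a c))
      (fun i => μ.real (isoPiece (F i) c a s)) (fun i => μ.real (isoPiece (F i) a s c ∩ isoPiece (F i) s a c))
      (fun _ _ => measureReal_nonneg) (fun _ _ => measureReal_le_one) hQnn hQB hQC (fun i _ => hV i)
  have hPQnn : 0 ≤ PQ := Finset.prod_nonneg hQnn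
  have hPann : 0 ≤ Pa := Finset.prod_nonneg fun _ _ => measureReal_nonneg
  have hPa1 : Pa ≤ 1 := Finset.prod_le_one (fun _ _ => measureReal_nonneg) fun _ _ => measureReal_le_one
  have hPQS : PQ ≤ Ps := Finset.prod_le_prod hQnn hQB
  have hPQC : PQ ≤ Pc := Finset.prod_le_prod hQnn hQC
  have hT : (1 - pas) * (1 - pac) * (1 - psc) * (3 + (1 - pas) * (1 - pac)) ≤
      (1 + (1 - pas) * (1 - pac)) * ((1 - pas) * (1 - psc) + (1 - pac) * (1 - psc)) := tri_halving hpas hpas1 hpac hpac1 hpsc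
  have hmul := halving_mul (A₁ := (1 - pas) * (1 - pac)) (B₁ := (1 - pas) * (1 - psc)) (C₁ := (1 - pac) * (1 - psc))
    (q₁ := (1 - pas) * (1 - pac) * (1 - psc)) (A₂ := Pa) (B₂ := Ps) (C₂ := Pc) (q₂ := PQ)
    (mul_nonneg hpas hpac) (by nlinarith [mul_le_mul hpas1 hpac1 hpac zero_le_one]) hPann hPa1
    (mul_nonneg (mul_nonneg hpas hpac) hpsc) hPQnn
    (by nlinarith [mul_nonneg (mul_nonneg hpas hpsc) (sub_nonneg.2 hpac1)])
    (by nlinarith [mul_nonneg (mul_nonneg hpac hpsc) (sub_nonneg.2 hpas1)]) hPQS hPQC hT hP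
  rw [eQ, eA, eS, eC]
  have := hmul; ring_nf; ring_nf at this; linarith

/-- **(v) for parallel compositions of (v)-pieces, `U, D` form**: under the hypotheses of `halvingIso_of_pieces`,
`μ(U)·μ(D) ≤ 2·μ(U ∩ D)` with `U = {s↔a} ∪ {c↔a}`, `D = {s↮c}`. [this work] -/
theorem halvingUD_of_pieces (w : Sym2 V → unitInterval) {a s c : V} (has : a ≠ s) (hac : a ≠ c) (hsc : s ≠ c)
    (part : V → ι) (hw : ∀ u v : V, u ∉ terms a s c → v ∉ terms a s c → part u ≠ part v → (w s(u, v) : ℝ) = 0)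
    (hV : ∀ i, (prodBernoulli w).real (isoPiece (piecePairs a s c part i) a s c ∩ isoPiece (piecePairs a s c part i) s a c) *
        (3 + (prodBernoulli w).real (isoPiece (piecePairs a s c part i) a s c)) ≤
      (1 + (prodBernoulli w).real (isoPiece (piecePairs a s c part i) a s c)) *
        ((prodBernoulli w).real (isoPiece (piecePairs a s c part i) s a c) +
          (prodBernoulli w).real (isoPiece (piecePairs a s c part i) c a s))) :
    (prodBernoulli w).real (openConn s a ∪ openConn c a) * (prodBernoulli w).real ((openConn s c)ᶜ) ≤
      2 * (prodBernoulli w).real ((openConn s a ∪ openConn c a) ∩ (openConn s c)ᶜ) :=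
  halvingUD_of_iso w (halvingIso_of_pieces w has hac hsc part hw hV)

end pieces

end Summit.CriticalPhenomena.PercolationContinuityZ3.Theorems.HalvingParallel
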